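import Summits.HubbardSuperconductivity.HubbardSuperconductivity.Theorems.BalabanIRBirGroundStateAverageLROSectorMultiplicity
import Literature.MathematicalPhysics.QuantumLattice.HubbardPairDensityCouplingFloor
import Literature.MathematicalPhysics.QuantumLattice.FreeFermiGasNoThermalPairFieldLRO
import Literature.MathematicalPhysics.QuantumLattice.HubbardRingPerronFrobeniusProofs
import HarnessLib

/-!
# Route BalabanIR — target `BirGroundStateAverageLRO`: window uniformisation of a pointwise floor, UNCONDITIONALLY and off COUNTABLY many couplings

Helper file `--supports stmt-HubbardSuperconductivity-2079`
(`Summit.HubbardSuperconductivity.HubbardSuperconductivity.Theses.BalabanIR.BirGroundStateAverageLRO`,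
the ground-state-AVERAGE `d_{x²-y²}` pair-field bound `c·L⁴·Re tr P ≤ Re tr (P Δ_d† Δ_d)` with ONE
constant `c` on a whole open WINDOW of couplings `U`). THESES-FREE (materialisation rule of the
route file: this module imports Literature modules and Theses-free Theorems modules only, so that
a structural closer of a restated target may import it); the target's body is spelled out verbatim.

Relation to `Theorems/BalabanIRBirGroundStateAverageLROWindowUniformisation.lean` (lead c18,
2026-08-17, namespace `…Theorems.BirGroundStateAverageLRO.Uniformisation`): that file records the
Baire step with the continuity of the ground projection `U ↦ P_{U,L}` off closed sets `C L` as a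
HYPOTHESIS (`birWindowFloor_of_pointwise_offCrossings`) and imports the route file. Here the
continuity input is PROVED (`Literature.MathematicalPhysics.QuantumLattice.SectorGroundProjContinuity`,
with `C L` closed and nowhere dense, and COUNTABLE by
`Theorems/BalabanIRBirGroundStateAverageLROSectorMultiplicity.lean`), so the uniformisation below is
unconditional; the Baire step is re-proved in the real-line form needed (`exists_Ioo_uniform_of_pointwise`)
to keep this module Theses-free.

The target asks `∃ c > 0` BEFORE `∀ U ∈ (U₁, U₂)`. This file shows that this uniformity in `U` is
free off a COUNTABLE set of couplings: if at EVERY coupling `U` of a window the bound holds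
eventually in even `L` with its own constant `c(U) > 0` (the *pointwise floor*), then on some
open sub-window one pair `(c, L₀)` works for every coupling outside a countable union
`⋃_L C_L` of closed, countable, nowhere dense sets (`dWaveAvg_uniform_offCountable_of_pointwise`,
`birGroundStateAverageLRO_offCountable_of_pointwise`). Ingredients:

* `exists_Ioo_uniform_of_pointwise` — abstract Baire uniformisation: functions `F L : ℝ → ℝ`
  continuous off closed sets `C L`, a pointwise floor on `(a, b)` ⇒ a uniform floor on a
  sub-window off `C L` (the closed sets `{u | ∀ L ≥ m, u ∉ C L → 1/(k+1) ≤ F L u}` cover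
  `(a, b)`; Baire category theorem in `ℝ`);
* `exists_nowhereDense_continuousOn_dWaveAvgRatio` — for each side `L` the ratio
  `U ↦ Re tr (P_U Δ_d†Δ_d) / (L⁴ Re tr P_U)` (`P_U` the projection onto the ground multiplet of
  `hubbardTorus 2 L 1 U` in the sector `(2⌊(1-δ)L²/2⌋, 0)`) is continuous off a closed, countable,
  nowhere dense set of couplings: `hubbardTorus 2 L 1 U = H(0) + U · Σ n↑n↓` is an affine
  Hermitian pencil preserving the sector, so
  `Literature.MathematicalPhysics.QuantumLattice.exists_isClosed_interior_empty_continuousOn_of_pencil`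
  (u.s.c. of the ground multiplicity, Hilbert–Schmidt continuity of the ground projection where
  the multiplicity is locally constant) and `exists_countable_eventually_finrank_eq_of_pencil`
  (`Theorems/BalabanIRBirGroundStateAverageLROSectorMultiplicity.lean`: the multiplicity is locally
  constant off a countable set — Weyl's inequality at couplings of maximal distinct-eigenvalue
  count, which are all but finitely many, after penalising the complement of the sector) apply;
* conversely the target trivially gives the pointwise floor (take `c(U) = c`), so the off-meagre
  form is an honest WEAKENING of the target (not restated here to keep the module Theses-free).

What the target asks IN ADDITION to the pointwise floor is therefore only the bound AT the
countably many exceptional couplings `⋃_L C_L` (level crossings of the finite-volume ground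
multiplets), cf. the crux census `Cruxes/BirGroundStateAverageLRO/STRATEGY-CENSUS.md`
§Decomposition D2 / §7.2 ("restate X_avg co-countably in U") and `PICKED.md` (lead c18). All
statements are folklore (Baire; Kato (1966) II-§5.1, §6.1).
-/

namespace Summit.HubbardSuperconductivity.HubbardSuperconductivity.Theorems

open Matrix Set Filter Topology
open Literature.MathematicalPhysics.QuantumLattice Literature.Probability.LatticeModels
open Literature.Computability.AlgebraicComplexity

/-! ### Abstract Baire uniformisation -/

/-- **Baire uniformisation of a pointwise floor.** Let `F L : ℝ → ℝ` (`L : ℕ`) be continuous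
off a closed set `C L`, and suppose that at every point `u` of an open interval `(a, b)` there
are `c > 0` and `L₀` with `c ≤ F L u` for all admissible `L ≥ L₀` (`good L`). Then on some open
sub-interval `(a', b') ⊆ (a, b)` ONE pair `(c, L₀)` works for every `u ∈ (a', b')` outside
`C L`: the closed sets `T_{k,m} = {u | ∀ L ≥ m admissible, u ∉ C L → 1/(k+1) ≤ F L u}` cover
`(a, b)`, so by the Baire category theorem one of them contains an open sub-interval.
[folklore] -/
theorem exists_Ioo_uniform_of_pointwise {a b : ℝ} (hab : a < b) (F : ℕ → ℝ → ℝ)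
    (C : ℕ → Set ℝ) (good : ℕ → Prop) (hC : ∀ L, IsClosed (C L))
    (hF : ∀ L, ContinuousOn (F L) (C L)ᶜ)
    (hpt : ∀ u ∈ Ioo a b, ∃ c : ℝ, 0 < c ∧ ∃ L₀ : ℕ, ∀ L, L₀ ≤ L → good L → c ≤ F L u) :
    ∃ a' b' : ℝ, a ≤ a' ∧ a' < b' ∧ b' ≤ b ∧ ∃ c : ℝ, 0 < c ∧ ∃ L₀ : ℕ, ∀ L, L₀ ≤ L → good L →
      ∀ u ∈ Ioo a' b', u ∉ C L → c ≤ F L u := by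
  classical
  -- the closed sets `T (k, m)`
  set T : ℕ × ℕ → Set ℝ := fun km =>
    ⋂ L : ℕ, ⋂ (_ : km.2 ≤ L ∧ good L),
      ((C L)ᶜ ∩ (F L) ⁻¹' Iio (1 / ((km.1 : ℝ) + 1)))ᶜ with hT
  have hTclosed : ∀ km, IsClosed (T km) := fun km =>
    isClosed_iInter fun L => isClosed_iInter fun _ =>
      ((hF L).isOpen_inter_preimage (hC L).isOpen_compl isOpen_Iio).isClosed_compl
  have hmemT : ∀ km u, u ∈ T km ↔
      ∀ L, km.2 ≤ L → good L → u ∉ C L → 1 / ((km.1 : ℝ) + 1) ≤ F L u := by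
    intro km u
    simp only [hT, mem_iInter, mem_compl_iff, mem_inter_iff, mem_preimage, mem_Iio, not_and,
      not_lt, and_imp]
  -- the countable closed cover of `ℝ`: the `T (k, m)` together with `(a, b)ᶜ`
  set f : Option (ℕ × ℕ) → Set ℝ := fun o => o.elim (Ioo a b)ᶜ T with hf
  have hfclosed : ∀ o, IsClosed (f o) := by
    rintro (_ | km)
    · exact isOpen_Ioo.isClosed_compl
    · exact hTclosed km
  have hcover : ⋃ o, f o = univ := by
    refine eq_univ_of_forall fun u => ?_
    by_cases hu : u ∈ Ioo a b
    · obtain ⟨c, hc, L₀, hL₀⟩ := hpt u hu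
      obtain ⟨k, hk⟩ := exists_nat_one_div_lt hc
      refine mem_iUnion.2 ⟨some (k, L₀), (hmemT (k, L₀) u).2 fun L hL hg _ => ?_⟩
      exact hk.le.trans (hL₀ L hL hg)
    · exact mem_iUnion.2 ⟨none, hu⟩
  have hdense := dense_iUnion_interior_of_closed hfclosed hcover
  obtain ⟨x, hx, hxab⟩ := hdense.exists_mem_open isOpen_Ioo (nonempty_Ioo.2 hab)
  obtain ⟨o, ho⟩ := mem_iUnion.1 hx
  rcases o with _ | km
  · exact absurd hxab (interior_subset ho)
  -- an open ball around `x` inside `interior (T km) ∩ (a, b)`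
  obtain ⟨ε, hε, hball⟩ :=
    Metric.isOpen_iff.1 (isOpen_interior.inter isOpen_Ioo) x ⟨ho, hxab⟩
  rw [Real.ball_eq_Ioo] at hball
  refine ⟨max a (x - ε), min b (x + ε), le_max_left _ _, ?_, min_le_left _ _,
    1 / ((km.1 : ℝ) + 1), by positivity, km.2, fun L hL hg u hu huC => ?_⟩
  · rcases hxab with ⟨hxa, hxb⟩
    exact max_lt (lt_min hab (by linarith)) (lt_min (by linarith) (by linarith))
  · have hu' : u ∈ Ioo (x - ε) (x + ε) :=
      ⟨(le_max_right _ _).trans_lt hu.1, hu.2.trans_le (min_le_right _ _)⟩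
    exact (hmemT km u).1 (interior_subset (hball hu').1) L hL hg huC

/-! ### Continuity of the ground-state average ratio in the coupling, for each side `L` -/

section Torus

variable (L : ℕ) [NeZero L]

/-- **The `d`-wave ground-state ratio is continuous in `U` off a closed, countable, nowhere dense
set.** For every side `L ≥ 1` and `δ ≥ -1` there are a closed, countable, nowhere dense
`C ⊆ ℝ` and a function
`F : ℝ → ℝ`, continuous on `ℝ \ C`, such that the target's bound
`c·L⁴·Re tr P_U ≤ Re tr (P_U Δ_d† Δ_d)` at `(δ, U, c, L)` is `c ≤ F U`; here
`F U = Re tr (P_U Δ_d† Δ_d) / (L⁴ Re tr P_U)`, `P_U` the projection onto the ground multiplet of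
`hubbardTorus 2 L 1 U` in the sector `(2⌊(1-δ)L²/2⌋, S^z = 0)`. (The torus Hubbard Hamiltonian
is the affine Hermitian pencil `H(0) + U·Σ_x n_{x↑}n_{x↓}` preserving the sector, so the ground
projection is continuous off the closed nowhere dense set of couplings where the ground
multiplicity jumps, `exists_isClosed_isNowhereDense_continuousOn_sectorGroundProj`; and
`Re tr P_U ≥ 1`.) The complement of `C` is exactly the set of couplings at which the ground
multiplicity is locally constant; it is countable by
`exists_countable_eventually_finrank_eq_of_pencil` (Kato's exceptional couplings). [folklore] -/
theorem exists_nowhereDense_continuousOn_dWaveAvgRatio (δ : ℝ) (hδ : -1 ≤ δ) :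
    ∃ (C : Set ℝ) (F : ℝ → ℝ), IsClosed C ∧ IsNowhereDense C ∧ C.Countable ∧
      ContinuousOn F Cᶜ ∧
      (∀ U : ℝ, U ∉ C ↔ ∀ᶠ V : ℝ in 𝓝 U,
        Module.finrank ℂ ↥(szSector (Λ := FermionTorus 2 L) (2 * ⌊(1 - δ) * (L : ℝ) ^ 2 / 2⌋₊) 0 ⊓
          Module.End.eigenspace (Matrix.toLin' (hubbardTorus 2 L 1 V))
            (((hubbardTorus 2 L 1 V).minEnergyOn
              (szSector (Λ := FermionTorus 2 L) (2 * ⌊(1 - δ) * (L : ℝ) ^ 2 / 2⌋₊) 0) : ℝ) : ℂ)) =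
        Module.finrank ℂ ↥(szSector (Λ := FermionTorus 2 L) (2 * ⌊(1 - δ) * (L : ℝ) ^ 2 / 2⌋₊) 0 ⊓
          Module.End.eigenspace (Matrix.toLin' (hubbardTorus 2 L 1 U))
            (((hubbardTorus 2 L 1 U).minEnergyOn
              (szSector (Λ := FermionTorus 2 L) (2 * ⌊(1 - δ) * (L : ℝ) ^ 2 / 2⌋₊) 0) : ℝ) : ℂ))) ∧
      ∀ U c : ℝ, (c ≤ F U ↔
        let N : ℕ := 2 * ⌊(1 - δ) * (L : ℝ) ^ 2 / 2⌋₊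
        let H := hubbardTorus 2 L 1 U
        let S := szSector (Λ := FermionTorus 2 L) N 0
        let E₀ := S ⊓ Module.End.eigenspace (Matrix.toLin' H) ((H.minEnergyOn S : ℝ) : ℂ)
        let P := projMatrix (E₀.map (Fock.toEuclidean (ι := Orb (FermionTorus 2 L)) :
          Fock (Orb (FermionTorus 2 L)) →ₗ[ℂ] EuclideanSpace ℂ (Finset (Orb (FermionTorus 2 L)))))
        c * (L : ℝ) ^ 4 * P.trace.re ≤
          (P * (Matrix.conjTranspose (pairField dWaveFormFactor L) *
            pairField dWaveFormFactor L)).trace.re) := by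
  classical
  set N : ℕ := 2 * ⌊(1 - δ) * (L : ℝ) ^ 2 / 2⌋₊ with hN
  set S : Submodule ℂ (Fock (Orb (FermionTorus 2 L))) := szSector (Λ := FermionTorus 2 L) N 0
    with hS
  set D : Matrix (Finset (Orb (FermionTorus 2 L))) (Finset (Orb (FermionTorus 2 L))) ℂ :=
    ∑ x : FermionTorus 2 L, numberOp x 0 * numberOp x 1 with hD
  set A : Matrix (Finset (Orb (FermionTorus 2 L))) (Finset (Orb (FermionTorus 2 L))) ℂ :=
    Matrix.conjTranspose (pairField dWaveFormFactor L) * pairField dWaveFormFactor L with hA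
  -- the pencil `hubbardTorus 2 L 1 U = H(0) + U • D`, Hermitian, preserving `S ≠ ⊥`
  have hpen : ∀ U : ℝ, hubbardTorus 2 L 1 U = hubbardTorus 2 L 1 0 + (U : ℂ) • D := fun U =>
    hubbardTorus_eq_zero_add_smul_interaction U
  have hHh : ∀ U : ℝ, (hubbardTorus 2 L 1 U).IsHermitian := fun U =>
    hubbardTorus_isHermitian (hamiltonian_isHermitian_and_commute_holds (fermionTorusGraph 2 L))
      1 U
  have hDeq : D = hubbardTorus 2 L 1 1 - hubbardTorus 2 L 1 0 := by
    rw [hpen 1, Complex.ofReal_one, one_smul, add_sub_cancel_left]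
  have hDh : D.IsHermitian := by rw [hDeq]; exact (hHh 1).sub (hHh 0)
  have hSH : ∀ v ∈ S, hubbardTorus 2 L 1 0 *ᵥ v ∈ S := fun v hv =>
    hubbardTorus_mulVec_mem_szSector 1 0 hv
  have hSD : ∀ v ∈ S, D *ᵥ v ∈ S := fun v hv => by
    rw [hDeq, sub_mulVec]
    exact S.sub_mem (hubbardTorus_mulVec_mem_szSector 1 1 hv)
      (hubbardTorus_mulVec_mem_szSector 1 0 hv)
  have hm : ⌊(1 - δ) * (L : ℝ) ^ 2 / 2⌋₊ ≤ Fintype.card (FermionTorus 2 L) := by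
    have hcard : Fintype.card (FermionTorus 2 L) = L ^ 2 := by simp
    rw [hcard]
    apply Nat.floor_le_of_le
    have hL : (0 : ℝ) ≤ (L : ℝ) ^ 2 := by positivity
    push_cast
    nlinarith
  have hSne : S ≠ ⊥ := by
    obtain ⟨⟨ψ, hψS, hψ0, -⟩, -⟩ := szSector_groundState (fermionTorusGraph 2 L) 1 0 hm
    exact fun h => hψ0 ((Submodule.eq_bot_iff _).1 h ψ hψS)
  have hSU : ∀ (U : ℝ), ∀ v ∈ S, hubbardTorus 2 L 1 U *ᵥ v ∈ S := fun U v hv =>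
    hubbardTorus_mulVec_mem_szSector 1 U hv
  -- the ground projection is continuous off a closed nowhere dense set
  set E : ℝ → Submodule ℂ (Fock (Orb (FermionTorus 2 L))) := fun U =>
    S ⊓ Module.End.eigenspace (Matrix.toLin' (hubbardTorus 2 L 1 U))
      (((hubbardTorus 2 L 1 U).minEnergyOn S : ℝ) : ℂ) with hE
  set P : ℝ → Matrix (Finset (Orb (FermionTorus 2 L))) (Finset (Orb (FermionTorus 2 L))) ℂ :=
    fun U => projMatrix ((E U).map
      (Fock.toEuclidean (ι := Orb (FermionTorus 2 L)) :
        Fock (Orb (FermionTorus 2 L)) →ₗ[ℂ] EuclideanSpace ℂ (Finset (Orb (FermionTorus 2 L)))))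
    with hP
  obtain ⟨C, hC, hCint, hPcont, hchar⟩ :=
    exists_isClosed_interior_empty_continuousOn_of_pencil (hHh 0) hDh S hSH hSD hSne
      (A := fun U => hubbardTorus 2 L 1 U) (e := fun U => (hubbardTorus 2 L 1 U).minEnergyOn S)
      (E := E) (P := P) hpen (fun _ => rfl) (fun _ => rfl) (fun _ => rfl)
  have hCn : IsNowhereDense C := by
    rw [IsNowhereDense, hC.closure_eq]
    exact hCint
  -- the exceptional set is countable
  obtain ⟨X, hX, hXloc⟩ := exists_countable_eventually_finrank_eq_of_pencil (hHh 0) hDh S hSH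
    hSD hSne (A := fun U => hubbardTorus 2 L 1 U) (E := E) hpen (fun _ => rfl)
  have hCc : C.Countable := hX.mono fun u huC => by
    by_contra huX
    exact ((hchar u).2 (hXloc u huX)) huC
  have htrpos : ∀ U : ℝ, 1 ≤ (P U).trace.re := fun U => by
    have h1 : (P U).trace.re = Module.finrank ℂ ↥(S ⊓ Module.End.eigenspace
        (Matrix.toLin' (hubbardTorus 2 L 1 U)) (((hubbardTorus 2 L 1 U).minEnergyOn S : ℝ) : ℂ)) :=
      re_trace_projMatrix_map_eq_finrank _
    rw [h1]
    exact Nat.one_le_cast.2 (Submodule.one_le_finrank_iff.mpr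
      (inf_eigenspace_minEnergyOn_ne_bot (hHh U) S (hSU U) hSne))
  have hL0 : (0 : ℝ) < (L : ℝ) := by exact_mod_cast Nat.pos_of_ne_zero (NeZero.ne L)
  have hden : ∀ U : ℝ, 0 < (L : ℝ) ^ 4 * (P U).trace.re := fun U => by
    have := htrpos U
    positivity
  set F : ℝ → ℝ := fun U => (P U * A).trace.re / ((L : ℝ) ^ 4 * (P U).trace.re) with hF
  have hFcont : ContinuousOn F Cᶜ := by
    have h1 : Continuous fun M : Matrix (Finset (Orb (FermionTorus 2 L)))
        (Finset (Orb (FermionTorus 2 L))) ℂ => (M * A).trace.re :=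
      Complex.continuous_re.comp ((continuous_id.matrix_mul continuous_const).matrix_trace)
    have h2 : Continuous fun M : Matrix (Finset (Orb (FermionTorus 2 L)))
        (Finset (Orb (FermionTorus 2 L))) ℂ => (L : ℝ) ^ 4 * M.trace.re :=
      continuous_const.mul (Complex.continuous_re.comp continuous_id.matrix_trace)
    exact (h1.comp_continuousOn hPcont).div (h2.comp_continuousOn hPcont)
      fun U _ => (hden U).ne'
  refine ⟨C, F, hC, hCn, hCc, hFcont, hchar, fun U c => ?_⟩
  rw [hF]
  dsimp only
  rw [le_div_iff₀ (hden U), ← mul_assoc]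

end Torus

/-! ### Window uniformisation of the pointwise floor -/

/-- **Pointwise floor on a window ⇒ ONE constant on a sub-window, off closed countable nowhere
dense sets of couplings** (parametric form). If at every coupling `U` of a window `(U₁, U₂)` the average bound
holds eventually in even `L` with a `U`-dependent constant `c(U) > 0`, then there are a
sub-window `U₁ ≤ U₁' < U₂' ≤ U₂`, ONE constant `c > 0`, ONE `L₀` and closed nowhere dense sets
`C_L ⊆ ℝ` such that the bound with constant `c` holds for all even `L ≥ L₀` at every coupling of
the sub-window outside `C_L` (Baire uniformisation `exists_Ioo_uniform_of_pointwise` of the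
continuous-off-`C_L` ratios `exists_nowhereDense_continuousOn_dWaveAvgRatio`). Compare the
`WindowUniformisation` clause of the crux census (`Cruxes/BirGroundStateAverageLRO/StrategistSketch.lean`
§D2), which asks the same WITHOUT the exception `U ∉ C_L`. [folklore] -/
theorem dWaveAvg_uniform_offCountable_of_pointwise {δ U₁ U₂ : ℝ} (hδ : -1 ≤ δ)
    (hU : U₁ < U₂)
    (hpw : ∀ U ∈ Set.Ioo U₁ U₂, ∃ c : ℝ, 0 < c ∧ ∃ L₀ : ℕ, ∀ (L : ℕ) [NeZero L], L₀ ≤ L →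
      Even L →
        let N : ℕ := 2 * ⌊(1 - δ) * (L : ℝ) ^ 2 / 2⌋₊
        let H := hubbardTorus 2 L 1 U
        let S := szSector (Λ := FermionTorus 2 L) N 0
        let E₀ := S ⊓ Module.End.eigenspace (Matrix.toLin' H) ((H.minEnergyOn S : ℝ) : ℂ)
        let P := projMatrix (E₀.map (Fock.toEuclidean (ι := Orb (FermionTorus 2 L)) :
          Fock (Orb (FermionTorus 2 L)) →ₗ[ℂ] EuclideanSpace ℂ (Finset (Orb (FermionTorus 2 L)))))
        c * (L : ℝ) ^ 4 * P.trace.re ≤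
          (P * (Matrix.conjTranspose (pairField dWaveFormFactor L) *
            pairField dWaveFormFactor L)).trace.re) :
    ∃ U₁' U₂' c : ℝ, U₁ ≤ U₁' ∧ U₁' < U₂' ∧ U₂' ≤ U₂ ∧ 0 < c ∧
      ∃ C : ℕ → Set ℝ, (∀ L, IsClosed (C L) ∧ IsNowhereDense (C L) ∧ (C L).Countable) ∧
        ∃ L₀ : ℕ, ∀ U ∈ Set.Ioo U₁' U₂', ∀ (L : ℕ) [NeZero L], L₀ ≤ L → Even L → U ∉ C L →
        let N : ℕ := 2 * ⌊(1 - δ) * (L : ℝ) ^ 2 / 2⌋₊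
        let H := hubbardTorus 2 L 1 U
        let S := szSector (Λ := FermionTorus 2 L) N 0
        let E₀ := S ⊓ Module.End.eigenspace (Matrix.toLin' H) ((H.minEnergyOn S : ℝ) : ℂ)
        let P := projMatrix (E₀.map (Fock.toEuclidean (ι := Orb (FermionTorus 2 L)) :
          Fock (Orb (FermionTorus 2 L)) →ₗ[ℂ] EuclideanSpace ℂ (Finset (Orb (FermionTorus 2 L)))))
        c * (L : ℝ) ^ 4 * P.trace.re ≤
          (P * (Matrix.conjTranspose (pairField dWaveFormFactor L) *
            pairField dWaveFormFactor L)).trace.re := by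
  classical
  -- per-`L` data (junk at `L = 0`)
  have per : ∀ L : ℕ, ∃ (C : Set ℝ) (F : ℝ → ℝ), IsClosed C ∧ IsNowhereDense C ∧
      C.Countable ∧ ContinuousOn F Cᶜ ∧ ∀ (hL : L ≠ 0) (U c : ℝ),
        haveI : NeZero L := ⟨hL⟩
        (c ≤ F U ↔
        let N : ℕ := 2 * ⌊(1 - δ) * (L : ℝ) ^ 2 / 2⌋₊
        let H := hubbardTorus 2 L 1 U
        let S := szSector (Λ := FermionTorus 2 L) N 0
        let E₀ := S ⊓ Module.End.eigenspace (Matrix.toLin' H) ((H.minEnergyOn S : ℝ) : ℂ)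
        let P := projMatrix (E₀.map (Fock.toEuclidean (ι := Orb (FermionTorus 2 L)) :
          Fock (Orb (FermionTorus 2 L)) →ₗ[ℂ] EuclideanSpace ℂ (Finset (Orb (FermionTorus 2 L)))))
        c * (L : ℝ) ^ 4 * P.trace.re ≤
          (P * (Matrix.conjTranspose (pairField dWaveFormFactor L) *
            pairField dWaveFormFactor L)).trace.re) := by
    intro L
    by_cases hL : L = 0
    · exact ⟨∅, fun _ => 0, isClosed_empty, isNowhereDense_empty, Set.countable_empty,
        continuousOn_const, fun h => absurd hL h⟩
    · haveI : NeZero L := ⟨hL⟩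
      obtain ⟨C, F, hC, hCn, hCc, hF, -, hiff⟩ :=
        exists_nowhereDense_continuousOn_dWaveAvgRatio L δ hδ
      exact ⟨C, F, hC, hCn, hCc, hF, fun _ U c => hiff U c⟩
  choose C F hCcl hCn hCco hFc hiff using per
  obtain ⟨a, b, ha, hab, hb, c, hc, L₀, hunif⟩ :=
    exists_Ioo_uniform_of_pointwise hU F C Even hCcl hFc fun U hU' => by
      obtain ⟨c, hc, L₀, hL₀⟩ := hpw U hU'
      refine ⟨c, hc, max L₀ 1, fun L hL hLe => ?_⟩
      have hL0 : L ≠ 0 := by omega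
      haveI : NeZero L := ⟨hL0⟩
      exact (hiff L hL0 U c).2 (hL₀ L (le_of_max_le_left hL) hLe)
  refine ⟨a, b, c, ha, hab, hb, hc, C, fun L => ⟨hCcl L, hCn L, hCco L⟩, max L₀ 1,
    fun U hU' L _ hL hLe hUC => ?_⟩
  have hL0 : L ≠ 0 := by
    have := le_of_max_le_right hL
    omega
  exact (hiff L hL0 U c).1 (hunif L (le_of_max_le_left hL) hLe U hU' hUC)

/-- **Pointwise floor ⇒ the target off a countable set of couplings** (`BirGroundStateAverageLRO`
with `U ∉ X` inserted, `X = ⋃_L C_L` a countable union of closed, countable, nowhere dense sets,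
hence COUNTABLE and meagre; even with `L₀` uniform in `U`). The hypothesis is `∃ δ U₁ U₂, … ∧ PointwiseFloorWindow δ U₁ U₂`
of the crux census, unfolded. [folklore] -/
theorem birGroundStateAverageLRO_offCountable_of_pointwise
    (h : ∃ δ ∈ Set.Ioo (0:ℝ) (1/2), ∃ U₁ U₂ : ℝ, 0 < U₁ ∧ U₁ < U₂ ∧
      ∀ U ∈ Set.Ioo U₁ U₂, ∃ c : ℝ, 0 < c ∧ ∃ L₀ : ℕ, ∀ (L : ℕ) [NeZero L], L₀ ≤ L → Even L →
        let N : ℕ := 2 * ⌊(1 - δ) * (L : ℝ) ^ 2 / 2⌋₊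
        let H := hubbardTorus 2 L 1 U
        let S := szSector (Λ := FermionTorus 2 L) N 0
        let E₀ := S ⊓ Module.End.eigenspace (Matrix.toLin' H) ((H.minEnergyOn S : ℝ) : ℂ)
        let P := projMatrix (E₀.map (Fock.toEuclidean (ι := Orb (FermionTorus 2 L)) :
          Fock (Orb (FermionTorus 2 L)) →ₗ[ℂ] EuclideanSpace ℂ (Finset (Orb (FermionTorus 2 L)))))
        c * (L : ℝ) ^ 4 * P.trace.re ≤
          (P * (Matrix.conjTranspose (pairField dWaveFormFactor L) *
            pairField dWaveFormFactor L)).trace.re) :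
    ∃ δ ∈ Set.Ioo (0:ℝ) (1/2), ∃ U₁ U₂ c : ℝ, 0 < U₁ ∧ U₁ < U₂ ∧ 0 < c ∧
      ∃ X : Set ℝ, X.Countable ∧ IsMeagre X ∧ ∃ L₀ : ℕ,
        ∀ U ∈ Set.Ioo U₁ U₂, U ∉ X → ∀ (L : ℕ) [NeZero L], L₀ ≤ L → Even L →
        let N : ℕ := 2 * ⌊(1 - δ) * (L : ℝ) ^ 2 / 2⌋₊
        let H := hubbardTorus 2 L 1 U
        let S := szSector (Λ := FermionTorus 2 L) N 0
        let E₀ := S ⊓ Module.End.eigenspace (Matrix.toLin' H) ((H.minEnergyOn S : ℝ) : ℂ)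
        let P := projMatrix (E₀.map (Fock.toEuclidean (ι := Orb (FermionTorus 2 L)) :
          Fock (Orb (FermionTorus 2 L)) →ₗ[ℂ] EuclideanSpace ℂ (Finset (Orb (FermionTorus 2 L)))))
        c * (L : ℝ) ^ 4 * P.trace.re ≤
          (P * (Matrix.conjTranspose (pairField dWaveFormFactor L) *
            pairField dWaveFormFactor L)).trace.re := by
  obtain ⟨δ, hδ, U₁, U₂, hU₁, hU₁₂, hpw⟩ := h
  obtain ⟨a, b, c, ha, hab, _, hc, C, hC, L₀, h⟩ :=
    dWaveAvg_uniform_offCountable_of_pointwise (by linarith [hδ.1]) hU₁₂ hpw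
  refine ⟨δ, hδ, a, b, c, by linarith, hab, hc, ⋃ L, C L, Set.countable_iUnion fun L => (hC L).2.2,
    isMeagre_iUnion fun L => (hC L).2.1.isMeagre, L₀, fun U hU hUX L _ hL hLe => ?_⟩
  exact h U hU L hL hLe fun hUC => hUX (Set.mem_iUnion.2 ⟨L, hUC⟩)

/-- **Pointwise floor ⇒ the co-countable target** — the same in the target's own quantifier shape
(`∀ U ∈ (U₁,U₂), U ∉ X → ∃ L₀, …` with `X` countable): the form in which a planner would restate
`BirGroundStateAverageLRO` "co-countably in `U`" (crux census §7.2); a structural closer of such a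
restated item is `…_of_pointwise <pointwise floor>`. [folklore] -/
theorem birGroundStateAverageLRO_coCountable_of_pointwise
    (h : ∃ δ ∈ Set.Ioo (0:ℝ) (1/2), ∃ U₁ U₂ : ℝ, 0 < U₁ ∧ U₁ < U₂ ∧
      ∀ U ∈ Set.Ioo U₁ U₂, ∃ c : ℝ, 0 < c ∧ ∃ L₀ : ℕ, ∀ (L : ℕ) [NeZero L], L₀ ≤ L → Even L →
        let N : ℕ := 2 * ⌊(1 - δ) * (L : ℝ) ^ 2 / 2⌋₊
        let H := hubbardTorus 2 L 1 U
        let S := szSector (Λ := FermionTorus 2 L) N 0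
        let E₀ := S ⊓ Module.End.eigenspace (Matrix.toLin' H) ((H.minEnergyOn S : ℝ) : ℂ)
        let P := projMatrix (E₀.map (Fock.toEuclidean (ι := Orb (FermionTorus 2 L)) :
          Fock (Orb (FermionTorus 2 L)) →ₗ[ℂ] EuclideanSpace ℂ (Finset (Orb (FermionTorus 2 L)))))
        c * (L : ℝ) ^ 4 * P.trace.re ≤
          (P * (Matrix.conjTranspose (pairField dWaveFormFactor L) *
            pairField dWaveFormFactor L)).trace.re) :
    ∃ δ ∈ Set.Ioo (0:ℝ) (1/2), ∃ U₁ U₂ c : ℝ, 0 < U₁ ∧ U₁ < U₂ ∧ 0 < c ∧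
      ∃ X : Set ℝ, X.Countable ∧
        ∀ U ∈ Set.Ioo U₁ U₂, U ∉ X → ∃ L₀ : ℕ, ∀ (L : ℕ) [NeZero L], L₀ ≤ L → Even L →
        let N : ℕ := 2 * ⌊(1 - δ) * (L : ℝ) ^ 2 / 2⌋₊
        let H := hubbardTorus 2 L 1 U
        let S := szSector (Λ := FermionTorus 2 L) N 0
        let E₀ := S ⊓ Module.End.eigenspace (Matrix.toLin' H) ((H.minEnergyOn S : ℝ) : ℂ)
        let P := projMatrix (E₀.map (Fock.toEuclidean (ι := Orb (FermionTorus 2 L)) :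
          Fock (Orb (FermionTorus 2 L)) →ₗ[ℂ] EuclideanSpace ℂ (Finset (Orb (FermionTorus 2 L)))))
        c * (L : ℝ) ^ 4 * P.trace.re ≤
          (P * (Matrix.conjTranspose (pairField dWaveFormFactor L) *
            pairField dWaveFormFactor L)).trace.re := by
  obtain ⟨δ, hδ, U₁, U₂, c, hU₁, hU₁₂, hc, X, hX, -, L₀, h⟩ :=
    birGroundStateAverageLRO_offCountable_of_pointwise h
  exact ⟨δ, hδ, U₁, U₂, c, hU₁, hU₁₂, hc, X, hX, fun U hU hUX => ⟨L₀, fun L _ hL hLe =>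
    h U hU hUX L hL hLe⟩⟩

end Summit.HubbardSuperconductivity.HubbardSuperconductivity.Theorems
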